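import Summits.QuantumFields.BalabanUV.T4Continuum.Support.CTKingTowerWeights
import Summits.QuantumFields.BalabanUV.T4Continuum.Support.BalabanAveragedCoerciveTower
import Literature.MathematicalPhysics.QuantumFieldTheory.Balaban1983to89.Beta.DeltaACombesThomasSets

/-!
# `BalabanUV.Beta.GAN24.UnitLatticeDecayAlgebra` — binder row G-an2-4 ∕ (CONV-C), route R7 «TWO CURRENCIES», PART 127: THE ENTRY-DECAY ALGEBRA ON THE UNIT
# LATTICE.  Decaying kernels are closed under PRODUCTS (volume-uniform convolution bound) and under INVERSION OF COERCIVE HERMITIAN kernels (the Combes–Thomas step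
# ON THE UNIT LATTICE: an entry decay at rate `κ` bounds the cosh row defect at any rate `κ′ ≤ κ₀ < κ` by `(κ′∕κ₀)²·B·S`, so a `γ`-coercive decaying kernel has an
# inverse decaying at every rate `κ′` with `(κ′∕κ₀)²·B·S < γ`) — generic over a finite index set with a «distance» and ONE summability letter `Σ_y e^{−c·dist(x,y)} ≤ S`;
# on the unit torus `idx L M 0` with the sup-distance `distK` the letter is the β-cell's volume-uniform `VectorTailsCov.sum_exp_tdist_le` (`d ≥ 2`)
# (unit b2b-balaban-gan24-p3, gen 52; v1)

NOT IN PRINT; OUR PROOF ([folklore] finite-dimensional linear algebra ∕ real analysis BY NAME over the substrate's `CTWeightedCoercivity` (`conjMat`, `ConjDefect`, `WCoercive`,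
`conjDefect_of_rowDefect`, `wCoercive_of_coercive`), the NE2 swarm's `CTAveragedTowerDecay.opNorm_conjMat_inv_le_of_wCoercive`, the β-cell's `Beta/DeltaACombesThomas` (`ctRowDefect`,
`ctWeight`) ∕ `Beta/DeltaACombesThomasSets.ctRowDefect_le_rate_sq` (the `(κ∕κ₀)²` scaling) ∕ `Beta/VectorTailsCov` (`tdist`, `sum_exp_tdist_le`), `CTKingTowerWeights` (`distK`, `toM`),
`BalabanAveragedTowerUnit.norm_entry_le_opNorm`; method references only: Combes–Thomas 1973 ∕ Agmon 1982; nothing printed is a hypothesis).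
HONEST FRAMING (cell contract, verbatim): «discharging `BetaPertH` makes Bałaban's UV stability UNCONDITIONAL — a real constructive-QFT result; it is NOT the
continuum limit and NOT the Clay problem.»  HONEST DEPENDENCY (verbatim): «continuum YM on T⁴ ⇐ BetaPertH ∧ nine spine estimates (0/9 proved); BetaPertH ⇐
(D1) ∧ (D4) ∧ CAP+tail; G-an2-4 gates asym, D1 and NE2/3/4.»

WHY THIS FILE.  PARTs 124–126 deliver LEVEL-UNIFORM ENTRY DECAY on the unit lattice for the fine-level constituents read through the averagings (King's or Bałaban's):
`hdec` for `c_k = Q_k𝒢Q_kᴴ`, for the insertion chains, etc.  The EFFECTIVE FORM of route R6 ∕ PART 118 is built from these by UNIT-LATTICE operations — an inverse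
(`Σ_k = c_k⁻¹ − a`, `c_k` uniformly coercive by `uniformCoercive_unitCovB`) and products (`Σ̇_k = c_k⁻¹ċ_kc_k⁻¹`, `Σ̈_k`, the 2 × 2 table's blocks).  So the decay half
for the effective form needs exactly two closure properties of «entry decay, constants free of the volume»: under products and under inversion of coercive Hermitian
kernels.  Both are volume-uniform iff the lattice sums `Σ_y e^{−c·dist(x,y)}` are — the ONE letter `S` below, which on the unit torus is the β-cell's
`sum_exp_tdist_le` (every volume, `d ≥ 2`).  The inversion is the Combes–Thomas argument run ON THE UNIT LATTICE with the weight `ρ_y = dist(·, y)` (1-Lipschitz by the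
triangle inequality): the cosh row defect of a kernel decaying at rate `κ` is, at a reference rate `κ₀ < κ`, at most `B·S(κ − κ₀)`, and at any `κ′ ≤ κ₀` at most `(κ′∕κ₀)²`
times that (`ctRowDefect_le_rate_sq`) — SMALL for small `κ′`, whence weighted coercivity `γ − J` and the decay of the inverse at rate `κ′`.  PART 128 instantiates this
on `unitCovB` and its u-derivatives.

WHAT THIS FILE PROVES (0 sorry, 0 `def`, nothing cited; `n` a finite index type, `dist : n → n → ℝ`; `EntryDecay dist M B δ := ∀ x y, ‖M x y‖ ≤ B·e^{−δ·dist x y}`):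
* §1 PRODUCTS: **`entryDecay_mul`** — `dist ≥ 0`, triangle inequality, `κ ≥ 0`, `Σ_z e^{−(κ∕2)dist(x,z)} ≤ S` for all `x`, `EntryDecay M B₁ κ`, `EntryDecay N B₂ κ` ⟹
  `EntryDecay (M·N) (B₁B₂S) (κ∕2)`; `entryDecay_smul`, `entryDecay_one` (`dist x x = 0`: `EntryDecay 1 1 δ` for any `δ` when `dist x y > 0 → …` — stated as `‖1 x y‖ ≤ e^{−δ·dist}` needs
  only `x ≠ y ⇒` nothing: we prove `EntryDecay dist 1 1 δ` under `dist x x = 0` and `δ·dist ≥ 0`-free form `‖(1:Matrix) x y‖ ≤ 1·e^{−δ dist x y}` for `x = y`, `0` else).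
* §2 ROW DEFECTS FROM ENTRY DECAY: **`ctRowDefect_le_of_entryDecay`** — `EntryDecay A B κ`, a weight with `|ρ e − ρ e′| ≤ dist e e′`, `0 ≤ κ₀`, `Σ_{e′} e^{−(κ − κ₀)dist(e,e′)} ≤ S`
  ⟹ `ctRowDefect A κ₀ ρ e ≤ B·S` (`cosh s − 1 ≤ e^{|s|}`, inlined); with `ctRowDefect_le_rate_sq`: **`ctRowDefect_le_sq_of_entryDecay`** — `ctRowDefect A κ′ ρ e ≤ (κ′∕κ₀)²·B·S` for `0 ≤ κ′ ≤ κ₀`,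
  `0 < κ₀`.
* §3 INVERSES: **`entryDecay_inv_of_coercive`** — `A` Hermitian and `γ`-coercive with `EntryDecay A B κ`; `dist` symmetric, triangle, `dist x x = 0`; `0 < κ₀`, `0 ≤ κ′ ≤ κ₀`,
  `Σ_{e′} e^{−(κ−κ₀)dist} ≤ S`, and `J := (κ′∕κ₀)²·B·S < γ` ⟹ `EntryDecay dist A⁻¹ ((γ − J)⁻¹) κ′`; the packaged smallness **`exists_rate_inv`**-free form is left to the instance
  (the condition is one real inequality).
* §4 THE UNIT TORUS: `distK_self`, `distK_nonneg`, `distK_triangle`; **`sum_exp_distK_le`** — `d ≥ 2`, `c > 0` ⟹ `∃ S ≥ 0, ∀ L M x, Σ_{y : idx L M 0} e^{−c·distK x y} ≤ S` (`d` copies of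
  `sum_exp_tdist_le` through the reading `toM`, a bijection onto `Tor M`); **`entryDecay_mul_distK`**, **`entryDecay_inv_distK`** — §1 ∕ §3 on `idx L M 0` with the letter fed.
WHAT IT DOES NOT DO: anything fine-level (that is PARTs 124–126); Bałaban's objects (PART 128 instantiates); infinite volume (the torus is finite; the constants are volume-free).
SUPPLIER work; no consumer of record; NEVER «G-an2-4 closed»; NOT (CONV-C), NOT D1, NOT `BetaPertH`, NOT continuum, NOT Clay.  Records: `HOME/b2b-balaban-gan24-p3/gen52/README.md`.
-/

noncomputable section

open scoped BigOperators ComplexConjugate Matrix Matrix.Norms.L2Operator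
open Filter Topology

namespace Summit.QuantumFields.BalabanUV.Beta.GAN24.UnitLatticeDecayAlgebra

open Literature.MathematicalPhysics.QuantumFieldTheory.Balaban1983to89.B5Prop11Plancherel (Tor fine)
open Literature.MathematicalPhysics.QuantumFieldTheory.Balaban1983to89.B5G183RateUnitTower (lev)
open Literature.MathematicalPhysics.QuantumFieldTheory.Balaban1983to89.Beta.VectorTailsCov (tdist tdist_self tdist_triangle tdist_comm sum_exp_tdist_le)
open Literature.MathematicalPhysics.QuantumFieldTheory.Balaban1983to89.Beta.DeltaACombesThomas (ctWeight ctRowDefect)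
open Literature.MathematicalPhysics.QuantumFieldTheory.Balaban1983to89.Beta.DeltaACombesThomasSets (ctRowDefect_le_rate_sq)
open Summit.QuantumFields.BalabanUV.T4Continuum
open Summit.QuantumFields.BalabanUV.T4Continuum.CoerciveInverseTower (Coercive)
open Summit.QuantumFields.BalabanUV.T4Continuum.BalabanAveragedTowerUnit (idx norm_entry_le_opNorm)
open Summit.QuantumFields.BalabanUV.T4Continuum.BalabanAveragedCoerciveTower (unitSites val_unitSites)
open Summit.QuantumFields.BalabanUV.T4Continuum.CTWeightedCoercivity (conjMat conjMat_apply ConjDefect WCoercive conjDefect_of_rowDefect wCoercive_of_coercive)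
open Summit.QuantumFields.BalabanUV.T4Continuum.CTAveragedTowerDecay (opNorm_conjMat_inv_le_of_wCoercive)
open Summit.QuantumFields.BalabanUV.T4Continuum.CTKingTowerWeights (toM val_toM distK distK_comm)
open Summit.QuantumFields.BalabanUV.T4Continuum.DecayRateInterpolation (EntryDecay)

/-! ## §1 Products of decaying kernels -/

section Generic

variable {n : Type*} [Fintype n] [DecidableEq n] {dist : n → n → ℝ}

omit [DecidableEq n] in
/-- **`entryDecay_mul` — PRODUCTS OF DECAYING KERNELS DECAY** [folklore]: with `dist ≥ 0`, the triangle inequality, `κ ≥ 0` and the summability letter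
`Σ_z e^{−(κ∕2)·dist(x,z)} ≤ S` (every `x`), `EntryDecay dist M B₁ κ` and `EntryDecay dist N B₂ κ` give `EntryDecay dist (M·N) (B₁B₂S) (κ∕2)`
(`e^{−κ(d(x,z) + d(z,y))} ≤ e^{−(κ∕2)d(x,y)}·e^{−(κ∕2)d(x,z)}`). -/
theorem entryDecay_mul (hd0 : ∀ x y, 0 ≤ dist x y) (htri : ∀ x y z, dist x y ≤ dist x z + dist z y) {κ S B₁ B₂ : ℝ} (hκ : 0 ≤ κ)
    (hS : ∀ x, ∑ z, Real.exp (-(κ / 2 * dist x z)) ≤ S) {M N : Matrix n n ℂ} (hM : EntryDecay dist M B₁ κ) (hN : EntryDecay dist N B₂ κ) :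
    EntryDecay dist (M * N) (B₁ * B₂ * S) (κ / 2) := by
  classical
  intro x y
  have hB₁ : 0 ≤ B₁ := by
    obtain ⟨x⟩ := (⟨x⟩ : Nonempty n)
    have := (norm_nonneg _).trans (hM x x); exact nonneg_of_mul_nonneg_left this (Real.exp_pos _)
  have hB₂ : 0 ≤ B₂ := by
    have := (norm_nonneg _).trans (hN x x); exact nonneg_of_mul_nonneg_left this (Real.exp_pos _)
  rw [Matrix.mul_apply]
  calc ‖∑ z, M x z * N z y‖ ≤ ∑ z, ‖M x z * N z y‖ := norm_sum_le _ _
    _ ≤ ∑ z, (B₁ * B₂ * Real.exp (-(κ / 2 * dist x y))) * Real.exp (-(κ / 2 * dist x z)) := by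
        refine Finset.sum_le_sum fun z _ => ?_
        rw [norm_mul]
        have h1 := hM x z
        have h2 := hN z y
        have hexp : Real.exp (-(κ * dist x z)) * Real.exp (-(κ * dist z y))
            ≤ Real.exp (-(κ / 2 * dist x y)) * Real.exp (-(κ / 2 * dist x z)) := by
          rw [← Real.exp_add, ← Real.exp_add]
          refine Real.exp_le_exp.mpr ?_
          have := htri x y z
          have := hd0 z y
          nlinarith
        calc ‖M x z‖ * ‖N z y‖ ≤ (B₁ * Real.exp (-(κ * dist x z))) * (B₂ * Real.exp (-(κ * dist z y))) :=
              mul_le_mul h1 h2 (norm_nonneg _) (mul_nonneg hB₁ (Real.exp_pos _).le)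
          _ = B₁ * B₂ * (Real.exp (-(κ * dist x z)) * Real.exp (-(κ * dist z y))) := by ring
          _ ≤ B₁ * B₂ * (Real.exp (-(κ / 2 * dist x y)) * Real.exp (-(κ / 2 * dist x z))) :=
              mul_le_mul_of_nonneg_left hexp (mul_nonneg hB₁ hB₂)
          _ = (B₁ * B₂ * Real.exp (-(κ / 2 * dist x y))) * Real.exp (-(κ / 2 * dist x z)) := by ring
    _ = (B₁ * B₂ * Real.exp (-(κ / 2 * dist x y))) * ∑ z, Real.exp (-(κ / 2 * dist x z)) := by rw [Finset.mul_sum]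
    _ ≤ (B₁ * B₂ * Real.exp (-(κ / 2 * dist x y))) * S :=
        mul_le_mul_of_nonneg_left (hS x) (by positivity)
    _ = B₁ * B₂ * S * Real.exp (-(κ / 2 * dist x y)) := by ring

omit [Fintype n] [DecidableEq n] in
/-- scalar multiples. [folklore] -/
theorem entryDecay_smul {M : Matrix n n ℂ} {B δ : ℝ} (hM : EntryDecay dist M B δ) (c : ℂ) : EntryDecay dist (c • M) (‖c‖ * B) δ := by
  intro x y
  rw [Matrix.smul_apply, smul_eq_mul, norm_mul, mul_assoc]
  exact mul_le_mul_of_nonneg_left (hM x y) (norm_nonneg c)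

omit [Fintype n] in
/-- the identity decays at every rate (`dist x x = 0`). [folklore] -/
theorem entryDecay_one (hd : ∀ x, dist x x = 0) (δ : ℝ) : EntryDecay dist (1 : Matrix n n ℂ) 1 δ := by
  intro x y
  by_cases hxy : x = y
  · subst hxy; rw [Matrix.one_apply_eq, norm_one, hd, mul_zero, neg_zero, Real.exp_zero, mul_one]
  · rw [Matrix.one_apply_ne hxy, norm_zero]; positivity

/-! ## §2 Row defects from entry decay -/

omit [DecidableEq n] in
/-- **`ctRowDefect_le_of_entryDecay`** [folklore]: a kernel with `EntryDecay dist A B κ`, a weight `ρ` that is 1-Lipschitz for `dist`, and the letter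
`Σ_{e′} e^{−(κ − κ₀)·dist(e,e′)} ≤ S` (`κ₀ ≥ 0`) has cosh row defect `ctRowDefect A κ₀ ρ e ≤ B·S` at the reference rate `κ₀` (`cosh s − 1 ≤ e^{|s|} ≤ e^{κ₀·dist}`). -/
theorem ctRowDefect_le_of_entryDecay {A : Matrix n n ℂ} {B κ κ₀ S : ℝ} (hA : EntryDecay dist A B κ) (hκ₀ : 0 ≤ κ₀) {ρ : n → ℝ}
    (hρ : ∀ e e', |ρ e - ρ e'| ≤ dist e e') (hS : ∀ e, ∑ e', Real.exp (-((κ - κ₀) * dist e e')) ≤ S) (e : n) :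
    ctRowDefect A κ₀ ρ e ≤ B * S := by
  have hB : 0 ≤ B := by
    have := (norm_nonneg _).trans (hA e e); exact nonneg_of_mul_nonneg_left this (Real.exp_pos _)
  unfold ctRowDefect ctWeight
  calc ∑ e', ‖A e e'‖ * (Real.cosh (κ₀ * (ρ e - ρ e')) - 1)
      ≤ ∑ e', B * Real.exp (-((κ - κ₀) * dist e e')) := by
        refine Finset.sum_le_sum fun e' _ => ?_
        have hc : Real.cosh (κ₀ * (ρ e - ρ e')) - 1 ≤ Real.exp (κ₀ * dist e e') := by
          have h1 : Real.cosh (κ₀ * (ρ e - ρ e')) ≤ Real.exp |κ₀ * (ρ e - ρ e')| := by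
            -- `cosh s ≤ e^{|s|}` (in the tree as `Literature.Analysis.Complex.DeBruijn1950.cosh_le_exp_abs`; two lines here to keep the import cone physical)
            rw [Real.cosh_eq]
            have ha : Real.exp (κ₀ * (ρ e - ρ e')) ≤ Real.exp |κ₀ * (ρ e - ρ e')| := Real.exp_le_exp.mpr (le_abs_self _)
            have hb : Real.exp (-(κ₀ * (ρ e - ρ e'))) ≤ Real.exp |κ₀ * (ρ e - ρ e')| := Real.exp_le_exp.mpr (neg_le_abs _)
            linarith
          have h2 : |κ₀ * (ρ e - ρ e')| ≤ κ₀ * dist e e' := by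
            rw [abs_mul, abs_of_nonneg hκ₀]; exact mul_le_mul_of_nonneg_left (hρ e e') hκ₀
          linarith [Real.exp_le_exp.mpr h2, Real.exp_pos (κ₀ * dist e e')]
        have hc0 : 0 ≤ Real.cosh (κ₀ * (ρ e - ρ e')) - 1 := by linarith [Real.one_le_cosh (κ₀ * (ρ e - ρ e'))]
        calc ‖A e e'‖ * (Real.cosh (κ₀ * (ρ e - ρ e')) - 1) ≤ (B * Real.exp (-(κ * dist e e'))) * Real.exp (κ₀ * dist e e') :=
              mul_le_mul (hA e e') hc hc0 (mul_nonneg hB (Real.exp_pos _).le)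
          _ = B * Real.exp (-((κ - κ₀) * dist e e')) := by
              rw [mul_assoc, ← Real.exp_add]; congr 2; ring
    _ = B * ∑ e', Real.exp (-((κ - κ₀) * dist e e')) := by rw [Finset.mul_sum]
    _ ≤ B * S := mul_le_mul_of_nonneg_left (hS e) hB

omit [DecidableEq n] in
/-- **`ctRowDefect_le_sq_of_entryDecay`** [folklore]: at any rate `0 ≤ κ′ ≤ κ₀` (`0 < κ₀`) the cosh row defect is `≤ (κ′∕κ₀)²·B·S` — SMALL for small `κ′`, with `S` the letter at the
reference gap `κ − κ₀` (`DeltaACombesThomasSets.ctRowDefect_le_rate_sq` + §2). -/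
theorem ctRowDefect_le_sq_of_entryDecay {A : Matrix n n ℂ} {B κ κ₀ κ' S : ℝ} (hA : EntryDecay dist A B κ) (hκ₀ : 0 < κ₀) (hκ' : 0 ≤ κ')
    (hle : κ' ≤ κ₀) {ρ : n → ℝ} (hρ : ∀ e e', |ρ e - ρ e'| ≤ dist e e') (hS : ∀ e, ∑ e', Real.exp (-((κ - κ₀) * dist e e')) ≤ S) (e : n) :
    ctRowDefect A κ' ρ e ≤ (κ' / κ₀) ^ 2 * (B * S) :=
  (ctRowDefect_le_rate_sq A ρ hκ₀ hκ' hle e).trans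
    (mul_le_mul_of_nonneg_left (ctRowDefect_le_of_entryDecay hA hκ₀.le hρ hS e) (sq_nonneg _))

/-! ## §3 Inverses of coercive Hermitian decaying kernels (Combes–Thomas on the index set itself) -/

omit [Fintype n] [DecidableEq n] in
/-- the distance to a fixed site is 1-Lipschitz (triangle inequality + symmetry). [folklore] -/
theorem abs_dist_sub_dist_le (hsymm : ∀ x y, dist x y = dist y x) (htri : ∀ x y z, dist x y ≤ dist x z + dist z y) (y e e' : n) :
    |dist e y - dist e' y| ≤ dist e e' := by
  rw [abs_le]
  constructor
  · have := htri e' y e; rw [hsymm e' e] at this; linarith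
  · have := htri e y e'; linarith

/-- **`entryDecay_inv_of_coercive` — THE INVERSE OF A COERCIVE HERMITIAN DECAYING KERNEL DECAYS** [our proof].  Let `A` be Hermitian and `γ`-coercive with
`EntryDecay dist A B κ`; let `dist` be symmetric with the triangle inequality and `dist x x = 0`; let `0 < κ₀`, `0 ≤ κ′ ≤ κ₀`, `Σ_{e′} e^{−(κ−κ₀)dist(e,e′)} ≤ S` (every `e`) and
`J := (κ′∕κ₀)²·B·S < γ`.  Then `EntryDecay dist A⁻¹ ((γ − J)⁻¹) κ′`: for each column `y` conjugate by `e^{κ′·dist(·,y)}` — the row defect is `≤ J` (§2), so `A` is weighted-coercive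
with `γ − J` (`wCoercive_of_coercive`), `‖e^{κ′ρ}A⁻¹e^{−κ′ρ}‖ ≤ (γ − J)⁻¹`, and the `(x,y)` entry of the conjugated inverse is `e^{κ′dist(x,y)}·A⁻¹(x,y)`. -/
theorem entryDecay_inv_of_coercive {A : Matrix n n ℂ} (hA : A.IsHermitian) {γ : ℝ} (hco : Coercive γ A) {B κ κ₀ κ' S : ℝ}
    (hdec : EntryDecay dist A B κ) (hsymm : ∀ x y, dist x y = dist y x) (htri : ∀ x y z, dist x y ≤ dist x z + dist z y)
    (hself : ∀ x, dist x x = 0) (hκ₀ : 0 < κ₀) (hκ' : 0 ≤ κ') (hle : κ' ≤ κ₀)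
    (hS : ∀ e, ∑ e', Real.exp (-((κ - κ₀) * dist e e')) ≤ S) (hJ : (κ' / κ₀) ^ 2 * (B * S) < γ) :
    EntryDecay dist A⁻¹ ((γ - (κ' / κ₀) ^ 2 * (B * S))⁻¹) κ' := by
  intro x y
  set J : ℝ := (κ' / κ₀) ^ 2 * (B * S) with hJdef
  set ρ : n → ℝ := fun e => dist e y with hρ
  have hρL : ∀ e e', |ρ e - ρ e'| ≤ dist e e' := fun e e' => abs_dist_sub_dist_le hsymm htri y e e'
  have hrow : ∀ e, ctRowDefect A κ' ρ e ≤ J := fun e => ctRowDefect_le_sq_of_entryDecay hdec hκ₀ hκ' hle hρL hS e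
  have hW : WCoercive A κ' ρ (γ - J) := wCoercive_of_coercive hco (conjDefect_of_rowDefect hA hrow)
  have hγJ : 0 < γ - J := sub_pos.mpr hJ
  have hop := opNorm_conjMat_inv_le_of_wCoercive hW hγJ
  have hent := (norm_entry_le_opNorm (conjMat κ' ρ ρ A⁻¹) x y).trans hop
  rw [conjMat_apply, norm_mul, Complex.norm_real, Real.norm_of_nonneg (Real.exp_pos _).le, hρ] at hent
  simp only [hself, sub_zero] at hent
  -- `e^{κ′dist(x,y)}·‖A⁻¹ x y‖ ≤ (γ − J)⁻¹`
  have hexp : 0 < Real.exp (κ' * dist x y) := Real.exp_pos _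
  rw [Real.exp_neg]
  rw [← div_eq_mul_inv, le_div_iff₀ hexp, mul_comm]
  exact hent

end Generic

/-! ## §4 The unit torus `idx L M 0` with the sup-distance `distK` -/

section Torus

variable {d : ℕ} (L : ℕ) [NeZero L] (M : Fin d → ℕ) [hM : ∀ μ, NeZero (M μ)]

omit [NeZero L] hM in
/-- `distK x x = 0`. [folklore] -/
theorem distK_self (x : idx L M 0) : distK L M x x = 0 := by
  unfold distK; rw [tdist_self, Nat.cast_zero]

omit [NeZero L] hM in
/-- `distK ≥ 0`. [folklore] -/
theorem distK_nonneg (x y : idx L M 0) : 0 ≤ distK L M x y := Nat.cast_nonneg _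

omit [NeZero L] in
/-- the triangle inequality for `distK`. [folklore] -/
theorem distK_triangle (x y z : idx L M 0) : distK L M x y ≤ distK L M x z + distK L M z y := by
  unfold distK
  exact_mod_cast tdist_triangle (toM L M x.1) (toM L M z.1) (toM L M y.1)

/-- the reading `toM` of the unit lattice in `Tor M` is a bijection (it is `unitSites`, `.val`-preserving). [folklore] -/
theorem toM_bijective : Function.Bijective (toM L M) := by
  have e : toM L M = unitSites M := by
    funext y; funext ν; apply ZMod.val_injective
    rw [val_toM, val_unitSites]; exact rfl
  rw [e]; exact (unitSites M).bijective

/-- **`sum_exp_distK_le` — THE VOLUME-UNIFORM SUMMABILITY LETTER ON THE UNIT TORUS** [folklore] (`d ≥ 2`, `c > 0`): `∃ S ≥ 0` depending on `(c, d)` only with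
`Σ_{y : idx L M 0} e^{−c·distK x y} ≤ S` for EVERY `L`, EVERY torus `M` and every `x` — `d` copies (the direction index) of the β-cell's `sum_exp_tdist_le` read through `toM`. -/
theorem sum_exp_distK_le (hd : 2 ≤ d) {c : ℝ} (hc : 0 < c) :
    ∃ S : ℝ, 0 ≤ S ∧ ∀ (L : ℕ) [NeZero L] (M : Fin d → ℕ) [∀ μ, NeZero (M μ)] (x : idx L M 0),
      ∑ y : idx L M 0, Real.exp (-(c * distK L M x y)) ≤ d * S := by
  obtain ⟨S, hS0, hS⟩ := sum_exp_tdist_le hd hc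
  refine ⟨S, hS0, fun L _ M _ x => ?_⟩
  rw [Fintype.sum_prod_type]
  have hinner : ∀ ys : Tor (fine (lev L 0) M), ∑ μ : Fin d, Real.exp (-(c * distK L M x (ys, μ)))
      = (d : ℝ) * Real.exp (-(c * (tdist (toM L M x.1) (toM L M ys) : ℝ))) := by
    intro ys
    simp only [distK, Finset.sum_const, Finset.card_univ, Fintype.card_fin, nsmul_eq_mul]
  simp_rw [hinner]
  rw [← Finset.mul_sum]
  refine mul_le_mul_of_nonneg_left ?_ (Nat.cast_nonneg d)
  -- reindex the site sum along the bijection `toM`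
  have e := Fintype.sum_bijective (toM L M) (toM_bijective L M)
    (fun ys => Real.exp (-(c * (tdist (toM L M x.1) (toM L M ys) : ℝ))))
    (fun z => Real.exp (-(c * (tdist (toM L M x.1) z : ℝ)))) (fun ys => rfl)
  rw [e]
  exact hS M (toM L M x.1)

/-- **`entryDecay_mul_distK`** — products on the unit torus: `EntryDecay distK M B₁ κ`, `EntryDecay distK N B₂ κ`, `κ > 0`, `d ≥ 2` ⟹ `EntryDecay distK (M·N) (B₁B₂·dS) (κ∕2)` with the
volume-free letter `S = S(κ∕2, d)` of `sum_exp_distK_le`. [folklore] -/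
theorem entryDecay_mul_distK (hd : 2 ≤ d) {κ : ℝ} (hκ : 0 < κ) :
    ∃ S : ℝ, 0 ≤ S ∧ ∀ (L : ℕ) [NeZero L] (M : Fin d → ℕ) [∀ μ, NeZero (M μ)] (X Y : Matrix (idx L M 0) (idx L M 0) ℂ) (B₁ B₂ : ℝ),
      EntryDecay (distK L M) X B₁ κ → EntryDecay (distK L M) Y B₂ κ → EntryDecay (distK L M) (X * Y) (B₁ * B₂ * (d * S)) (κ / 2) := by
  obtain ⟨S, hS0, hS⟩ := sum_exp_distK_le hd (half_pos hκ)
  refine ⟨S, hS0, fun L _ M _ X Y B₁ B₂ hX hY => ?_⟩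
  exact entryDecay_mul (distK_nonneg L M) (distK_triangle L M) hκ.le (fun x => hS L M x) hX hY

/-- **`entryDecay_inv_distK`** — THE COMBES–THOMAS STEP ON THE UNIT TORUS [our proof] (`d ≥ 2`): for `0 < κ₀ < κ` let `S = d·S(κ − κ₀, d)` be the letter; then for every `L`, every torus
`M`, every Hermitian `γ`-coercive `A` with `EntryDecay distK A B κ` and every `0 ≤ κ′ ≤ κ₀` with `(κ′∕κ₀)²·B·S < γ`: `EntryDecay distK A⁻¹ ((γ − (κ′∕κ₀)²·B·S)⁻¹) κ′` — volume-free. -/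
theorem entryDecay_inv_distK (hd : 2 ≤ d) {κ κ₀ : ℝ} (hκ₀ : 0 < κ₀) (hκ : κ₀ < κ) :
    ∃ S : ℝ, 0 ≤ S ∧ ∀ (L : ℕ) [NeZero L] (M : Fin d → ℕ) [∀ μ, NeZero (M μ)] (A : Matrix (idx L M 0) (idx L M 0) ℂ) (γ B κ' : ℝ),
      A.IsHermitian → Coercive γ A → EntryDecay (distK L M) A B κ → 0 ≤ κ' → κ' ≤ κ₀ → (κ' / κ₀) ^ 2 * (B * (d * S)) < γ →
        EntryDecay (distK L M) A⁻¹ ((γ - (κ' / κ₀) ^ 2 * (B * (d * S)))⁻¹) κ' := by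
  obtain ⟨S, hS0, hS⟩ := sum_exp_distK_le hd (sub_pos.mpr hκ)
  refine ⟨S, hS0, fun L _ M _ A γ B κ' hA hco hdec hκ' hle hJ => ?_⟩
  exact entryDecay_inv_of_coercive hA hco hdec (distK_comm L M) (distK_triangle L M) (distK_self L M) hκ₀ hκ' hle (fun e => hS L M e) hJ

end Torus

end Summit.QuantumFields.BalabanUV.Beta.GAN24.UnitLatticeDecayAlgebra

end
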